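import Summits.Ventures.HSemireg.Pad4TowerLinePhaseTorus

/-!
# Pad4TowerLineStaticSpread — the STATIC PHASE-SPREAD COROLLARY of the phase-torus law (kernel form of memo §11)

WHAT IT IS.  A presentation-free consequence of the two typed ingredients already in the tree:
(M) `topMoment_eq_zero_of_classScreen` (an (A1)-clean integer LINE-`h` configuration has vanishing top-word moments
except the two `e e e e` / `ē ē ē ē` words) and the BOX form of the phase-torus certificate (`PhaseTorus.rot_step`:
for a phase measure `ω ≤ 0` off a set `A` hosted by a BOX — a free coordinate `f₀` and one adjacent pair
`{s f, s f + 1}` on every other coordinate — with vanishing admissible moments, `ω̂(1,1,1,1) = 0`; NO bound on `|A|`).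

* `PhaseTorus.boxLaw` — the torus-level box law (any size of `A`), 20 lines over `rot_step`.
* `omegaS h C mN mP : (Fin 4 → ZMod 4) → ℤ` — the STATIC volume measure of a configuration: the signed sum of
  `multiplicity × volume` (`volume = ∏ f lineCharge`) over the cells of each phase vector `τ`; it depends on the
  class data only (no presentation, no flow, no sign condition on the multiplicities).
* `omegaS_moment` — its Fourier coefficients at frequencies without a `2` ARE the design's top-word moments.
* `static_mu_eq_zero_of_posBox` / `static_mu_eq_zero_of_negBox` — **if the positive-phase set `{ω_S > 0}` (or the
  negative-phase set `{ω_S < 0}`) of an (A1)-clean integer LINE configuration is hosted by a box, then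
  `μ = C.wch mN mP eWord = 0`.**  Contrapositive (the screen of memo §11): `μ ≠ 0` forces BOTH phase sets to be
  non-box-coverable (in particular each has ≥ 5 points, and ≥ 8 by the counting remark of memo §9).

WHAT IT IS NOT.  Not a statement about monads beyond this necessary condition; not a census row; nothing here is a
SOURCE or a SEED; nothing toward (T_h), 18881 ∕ H2, HC_AV, HC_CM (HELD, binder only) or HC — none of them is proved.
Authors: control g5 (plan-lens-HodgeAV-control); the torus machinery is s4-prove-1 g32's `PhaseTorusLawProof`.
-/

namespace Summit.Ventures.HSemireg.PhaseTorus

open Finset BigOperators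

/-- **Box law** (torus level, no cardinality bound): a phase measure `ω ≤ 0` off a box-hosted set `A` with vanishing
admissible moments has `ω̂(1,1,1,1) = 0`.  Proof = the four rotations of `rot_step`, exactly as in
`phaseTorusLaw_holds` with the covering step replaced by the hypothesis. -/
theorem boxLaw (ω : PT → ℝ) (A : Finset PT) (hω : ∀ τ, τ ∉ A → ω τ ≤ 0)
    (hK : ∀ k, KAdm k → moment ω k = 0) (f₀ : Fin 4) (s : Fin 4 → ZMod 4)
    (hbox : ∀ a ∈ A, ∃ f, f ≠ f₀ ∧ (a f = s f ∨ a f = s f + 1)) :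
    moment ω (fun _ => 1) = 0 := by
  set P : ℂ := ∏ f ∈ Finset.univ.erase f₀, (starRingEnd ℂ) (zPair (s f)) / 2 with hP
  have hPne : P ≠ 0 := Finset.prod_ne_zero_iff.2 fun f _ =>
    div_ne_zero ((map_ne_zero _).2 (zPair_ne_zero _)) (by norm_num)
  have key : ∀ w : ZMod 4, (e (-w) * (P * moment ω (fun _ => 1) / 4)).re ≤ 0 := by
    intro w
    have h := rot_step ω A hω hK f₀ s hbox w
    rw [prod_cvec_one] at h
    have hrw : e (-w) / 4 * P * moment ω (fun _ => 1) = e (-w) * (P * moment ω (fun _ => 1) / 4) := by ring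
    rw [hrw] at h
    exact h
  have hz : P * moment ω (fun _ => 1) / 4 = 0 := by
    apply eq_zero_of_re_rot_nonpos
    · have := key 0; rwa [neg_zero, e_zero] at this
    · have := key 3; rwa [show (-3 : ZMod 4) = 1 from by decide, e_one] at this
    · have := key 2; rwa [show (-2 : ZMod 4) = 2 from by decide, e_two] at this
    · have := key 1; rwa [show (-1 : ZMod 4) = 3 from by decide, e_three] at this
  have h4 : (4 : ℂ) ≠ 0 := by norm_num
  rcases mul_eq_zero.1 ((div_eq_zero_iff.1 hz).resolve_right h4) with h | h
  · exact absurd h hPne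
  · exact h

/-- The box law in the unfolded `Complex.I ^ _` form used by the design-level files. -/
theorem boxLaw' (ω : PT → ℝ) (A : Finset PT) (hω : ∀ τ, τ ∉ A → ω τ ≤ 0)
    (hK : ∀ k : PT, ((∀ f, k f ≠ 2) ∧ k ≠ (fun _ => 1) ∧ k ≠ (fun _ => 3)) →
      (∑ τ : PT, (ω τ : ℂ) * Complex.I ^ (∑ f, k f * τ f).val) = 0)
    (f₀ : Fin 4) (s : Fin 4 → ZMod 4) (hbox : ∀ a ∈ A, ∃ f, f ≠ f₀ ∧ (a f = s f ∨ a f = s f + 1)) :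
    (∑ τ : PT, (ω τ : ℂ) * Complex.I ^ (∑ f, (1 : ZMod 4) * τ f).val) = 0 :=
  boxLaw ω A hω (fun k hk => hK k hk) f₀ s hbox

end Summit.Ventures.HSemireg.PhaseTorus

namespace Summit.Ventures.HSemireg.LinePhaseTorus

open Finset BigOperators Summit.Ventures.HSemireg Summit.Ventures.HSemireg.Pad4Tower

/-- The STATIC volume measure of a configuration on the phase torus: signed `multiplicity × volume` summed over
the cells of each phase vector (lower cells `+ mN`, upper cells `− mP`). -/
def omegaS (h : ℤ) (C : MConfig) (mN mP : MCell → ℤ) (τ : Fin 4 → ZMod 4) : ℤ :=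
  (∑ Z ∈ C.lower, if tau Z = τ then mN Z * ∏ f, lineCharge h Z f else 0) -
    ∑ P ∈ C.upper, if tau P = τ then mP P * ∏ f, lineCharge h P f else 0

/-- **(M), static form**: the Fourier coefficient of `ω_S` at a frequency `k` with no `2` is the design moment of the
top word `wordOf k`. -/
theorem omegaS_moment (h : ℤ) (C : MConfig) (mN mP : MCell → ℤ)
    (hline : ∀ Z ∈ C.lower ∪ C.upper, LineCell h Z) (k : Fin 4 → ZMod 4) (hk : ∀ f, k f ≠ 2) :
    (∑ τ : Fin 4 → ZMod 4, ((omegaS h C mN mP τ : ℝ) : ℂ) * Complex.I ^ (∑ f, k f * τ f).val) =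
      ((moment h C mN mP (wordOf k) : GaussianInt) : ℂ) := by
  classical
  have hL : ∀ Z ∈ C.lower, LineCell h Z := fun Z hZ => hline Z (Finset.mem_union_left _ hZ)
  have hU : ∀ P ∈ C.upper, LineCell h P := fun P hP => hline P (Finset.mem_union_right _ hP)
  set χ : (Fin 4 → ZMod 4) → ℂ := fun τ => Complex.I ^ (∑ f, k f * τ f).val with hχ
  -- the cell weight `multiplicity × volume` as a complex number
  set g : (MCell → ℤ) → MCell → ℂ := fun m Z => (m Z : ℂ) * ∏ f, (lineCharge h Z f : ℂ) with hgdef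
  have hlhs : (∑ τ : Fin 4 → ZMod 4, ((omegaS h C mN mP τ : ℝ) : ℂ) * χ τ) =
      ∑ Z ∈ C.lower, g mN Z * χ (tau Z) - ∑ P ∈ C.upper, g mP P * χ (tau P) := by
    have e1 : ∀ τ, ((omegaS h C mN mP τ : ℝ) : ℂ) * χ τ =
        ∑ Z ∈ C.lower, (if tau Z = τ then g mN Z * χ τ else 0) -
          ∑ P ∈ C.upper, (if tau P = τ then g mP P * χ τ else 0) := by
      intro τ
      unfold omegaS; push_cast
      rw [sub_mul, Finset.sum_mul, Finset.sum_mul]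
      congr 1 <;> refine Finset.sum_congr rfl fun x _ => ?_ <;> split_ifs <;> simp [hgdef]
    rw [Finset.sum_congr rfl fun τ _ => e1 τ, Finset.sum_sub_distrib, Finset.sum_comm,
      Finset.sum_comm (s := Finset.univ) (t := C.upper)]
    congr 1 <;> refine Finset.sum_congr rfl fun x _ => ?_ <;> rw [Finset.sum_ite_eq] <;> simp
  have hg : ∀ m : MCell → ℤ, ∀ Z, LineCell h Z →
      (m Z : ℂ) * ((MCell.mono h Z (wordOf k) : GaussianInt) : ℂ) = g m Z * χ (tau Z) := by
    intro m Z hZ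
    rw [toComplex_mono_wordOf hZ k hk, hgdef]
    push_cast; ring
  have hrhs : ((moment h C mN mP (wordOf k) : GaussianInt) : ℂ) =
      (∑ Z ∈ C.lower, g mN Z * χ (tau Z)) - ∑ P ∈ C.upper, g mP P * χ (tau P) := by
    unfold moment
    rw [map_sub, map_sum, map_sum]
    congr 1
    · refine Finset.sum_congr rfl fun Z hZ => ?_
      rw [zsmul_eq_mul, map_mul, map_intCast, hg mN Z (hL Z hZ)]
    · refine Finset.sum_congr rfl fun P hP => ?_
      rw [zsmul_eq_mul, map_mul, map_intCast, hg mP P (hU P hP)]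
  rw [hlhs, hrhs]

/-- The clean admissible moments of the static measure vanish, by (M) = `topMoment_eq_zero_of_classScreen`. -/
theorem omegaS_clean (h : ℤ) (C : MConfig) (mN mP : MCell → ℤ)
    (hline : ∀ Z ∈ C.lower ∪ C.upper, LineCell h Z) (hA1 : ClassScreen (C.wch mN mP))
    (k : Fin 4 → ZMod 4) (hk : (∀ f, k f ≠ 2) ∧ k ≠ (fun _ => 1) ∧ k ≠ (fun _ => 3)) :
    (∑ τ : Fin 4 → ZMod 4, ((omegaS h C mN mP τ : ℝ) : ℂ) * Complex.I ^ (∑ f, k f * τ f).val) = 0 := by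
  obtain ⟨hk2, hk1, hk3⟩ := hk
  rw [omegaS_moment h C mN mP hline k hk2, topMoment_eq_zero_of_classScreen h C mN mP hline hA1 (wordOf k)
    (wordOf_top hk2) (wordOf_ne hk2 (Or.inl ⟨rfl, rfl⟩) hk1) (wordOf_ne hk2 (Or.inr ⟨rfl, rfl⟩) hk3), map_zero]

/-- `μ` is the static measure's coefficient at `(1,1,1,1)`. -/
theorem omegaS_top (h : ℤ) (C : MConfig) (mN mP : MCell → ℤ)
    (hline : ∀ Z ∈ C.lower ∪ C.upper, LineCell h Z)
    (htop : (∑ τ : Fin 4 → ZMod 4, ((omegaS h C mN mP τ : ℝ) : ℂ) *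
      Complex.I ^ (∑ f, (1 : ZMod 4) * τ f).val) = 0) :
    C.wch mN mP eWord = 0 := by
  rw [omegaS_moment h C mN mP hline (fun _ => 1) (fun _ => by decide), wordOf_one] at htop
  have hμ : moment h C mN mP (fun _ => 2) = 0 :=
    GaussianInt.toComplex_injective (by rw [htop, map_zero])
  rw [wch_eWord_eq_moment_beta h, hμ]

/-- **Static phase-spread corollary, positive side**: if the positive-phase set `{τ : ω_S τ > 0}` of an (A1)-clean
integer LINE configuration is hosted by a box (free coordinate `f₀`, adjacent pair `{s f, s f + 1}` on each other
coordinate), then `μ = 0`.  No presentation, no flow, no sign hypothesis on the multiplicities. -/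
theorem static_mu_eq_zero_of_posBox (h : ℤ) (C : MConfig) (mN mP : MCell → ℤ)
    (hline : ∀ Z ∈ C.lower ∪ C.upper, LineCell h Z) (hA1 : ClassScreen (C.wch mN mP))
    (f₀ : Fin 4) (s : Fin 4 → ZMod 4)
    (hbox : ∀ τ, 0 < omegaS h C mN mP τ → ∃ f, f ≠ f₀ ∧ (τ f = s f ∨ τ f = s f + 1)) :
    C.wch mN mP eWord = 0 := by
  classical
  set A : Finset (Fin 4 → ZMod 4) := Finset.univ.filter fun τ => 0 < omegaS h C mN mP τ with hA
  apply omegaS_top h C mN mP hline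
  refine PhaseTorus.boxLaw' (fun τ => (omegaS h C mN mP τ : ℝ)) A ?_ (omegaS_clean h C mN mP hline hA1) f₀ s ?_
  · intro τ hτ
    have : ¬ 0 < omegaS h C mN mP τ := fun hp => hτ (by rw [hA]; exact Finset.mem_filter.mpr ⟨Finset.mem_univ _, hp⟩)
    exact_mod_cast not_lt.mp this
  · intro a ha
    exact hbox a (by rw [hA] at ha; exact (Finset.mem_filter.mp ha).2)

/-- **Static phase-spread corollary, negative side**: the same with the negative-phase set `{τ : ω_S τ < 0}`
(apply the box law to `−ω_S`). -/
theorem static_mu_eq_zero_of_negBox (h : ℤ) (C : MConfig) (mN mP : MCell → ℤ)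
    (hline : ∀ Z ∈ C.lower ∪ C.upper, LineCell h Z) (hA1 : ClassScreen (C.wch mN mP))
    (f₀ : Fin 4) (s : Fin 4 → ZMod 4)
    (hbox : ∀ τ, omegaS h C mN mP τ < 0 → ∃ f, f ≠ f₀ ∧ (τ f = s f ∨ τ f = s f + 1)) :
    C.wch mN mP eWord = 0 := by
  classical
  set A : Finset (Fin 4 → ZMod 4) := Finset.univ.filter fun τ => omegaS h C mN mP τ < 0 with hA
  apply omegaS_top h C mN mP hline
  have hneg := PhaseTorus.boxLaw' (fun τ => -(omegaS h C mN mP τ : ℝ)) A ?_ ?_ f₀ s ?_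
  · have hsum : (∑ τ : Fin 4 → ZMod 4, (((-(omegaS h C mN mP τ : ℝ)) : ℝ) : ℂ) *
        Complex.I ^ (∑ f, (1 : ZMod 4) * τ f).val) =
        -(∑ τ : Fin 4 → ZMod 4, ((omegaS h C mN mP τ : ℝ) : ℂ) * Complex.I ^ (∑ f, (1 : ZMod 4) * τ f).val) := by
      rw [← Finset.sum_neg_distrib]
      exact Finset.sum_congr rfl fun τ _ => by push_cast; ring
    rw [hsum] at hneg
    exact neg_eq_zero.mp hneg
  · intro τ hτ
    have : ¬ omegaS h C mN mP τ < 0 := fun hp => hτ (by rw [hA]; exact Finset.mem_filter.mpr ⟨Finset.mem_univ _, hp⟩)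
    have h0 : (0 : ℝ) ≤ (omegaS h C mN mP τ : ℝ) := by exact_mod_cast not_lt.mp this
    linarith
  · intro k hk
    have hsum : (∑ τ : Fin 4 → ZMod 4, (((-(omegaS h C mN mP τ : ℝ)) : ℝ) : ℂ) *
        Complex.I ^ (∑ f, k f * τ f).val) =
        -(∑ τ : Fin 4 → ZMod 4, ((omegaS h C mN mP τ : ℝ) : ℂ) * Complex.I ^ (∑ f, k f * τ f).val) := by
      rw [← Finset.sum_neg_distrib]
      exact Finset.sum_congr rfl fun τ _ => by push_cast; ring
    rw [hsum, omegaS_clean h C mN mP hline hA1 k hk, neg_zero]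
  · intro a ha
    exact hbox a (by rw [hA] at ha; exact (Finset.mem_filter.mp ha).2)

end Summit.Ventures.HSemireg.LinePhaseTorus
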